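import Literature.NumberTheory.EllipticCurves.IwasawaAlgebraSpecializationCoprimeProofs
import Literature.AnabelianGeometry.EtaleTheta.RootsOfUnityGaloisPrimePower
import HarnessLib

/-!
# Separation of scalars in `Λ = ℤ_p⟦X⟧` by the cyclotomic specialisations: a power series divisible by
# `Φ_{pⁿ}(1+X)` for infinitely many `n` is zero (Washington §7.1 / Kato §13.9 «independent of the choices»),
# with the distinguished-polynomial degree bound behind it and the norm trick `g₀² + p·g₁² = 0 ⇒ g₀ = g₁ = 0`
# (proofs only)

Topic `NumberTheory/EllipticCurves`, namespace `Literature.NumberTheory.EllipticCurves.IwasawaAlgebra` (the tree's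
`IwasawaAlgebra p = PowerSeries ℤ_[p]`).  THEOREMS ONLY (no definition, no named fact, no instance, no notation, no
`sorry`).  Typed by seat `bsd-cm-prr-ty1` g30 (literature-prover, cell bsd-cm) for the SUMMON K2C-2 of crux
`EllipticUnitValueSevenOfGZK` = stmt-BirchSwinnertonDyer-19945 (input (r4) «rank-one separation» of the rational half of
Kato's comparison (15.16.1)∘15.14): the SCALAR half of LEMMA S of the cell's reading note `K2cCollapse-g57.md` §2 — «a
non-zero element of `O_λ⟦T⟧[1/p]` has finitely many zeros `ζ − 1`, `ζ ∈ μ_{p^∞}`» — in the tree's currency of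
DIVISIBILITY by the distinguished polynomials `Φ_{p^{n+1}}(1+X) ∈ ℤ_p[X] ⊂ Λ` (so that no `p`-adic evaluation map is
needed here; the evaluation maps and their kernels are the sequel `IwasawaAlgebraCharacterEvaluation.lean`).

## The statements (all `p`)

* §1 **degree bound** `exists_natDegree_le_of_coe_dvd`: for `f ≠ 0` in `Λ` there is `N` such that every MONIC
  `g ∈ ℤ_p[X]` whose non-leading coefficients are divisible by `p` (a distinguished polynomial up to the constant term
  condition) with `(g : Λ) ∣ f` has `deg g ≤ N`.  Proof (Washington, proof of Thm. 7.3 / Lemma 13.7 pattern): write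
  `f = p^m·f₀` with `f̄₀ ≠ 0` in `𝔽_p⟦X⟧` (tree `exists_eq_C_pow_mul_and_map_residue_ne_zero`); `p^m` and `g` are
  relatively prime in `Λ` (tree `isRelPrime_C_pow_coe_of_monic`), so `g ∣ p^m f₀ ⇒ g ∣ f₀`; reducing mod `p`,
  `ḡ = X^{deg g}` divides `f̄₀`, whence `deg g ≤ ord_X f̄₀`.  Hence `finite_setOf_coe_dvd` /
  `eq_zero_of_infinite_setOf_coe_dvd` for any family of such polynomials of unbounded degree.
* §2 **the cyclotomic family** `Φ_{p^{n+1}}(1+X)` (written, as in the tree's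
  `cyclotomic_prime_pow_comp_X_add_one_isEisensteinAt_padicInt`, as
  `((cyclotomic (p^(n+1)) ℤ).comp (X+1)).map (Int.castRingHom ℤ_[p])`): monic of degree `pⁿ(p−1)`, Eisenstein at `p`
  (tree), divides `ω_{n+1} = (1+X)^{p^{n+1}} − 1` in `Λ`, degrees unbounded; and
  ★ `eq_zero_of_infinite_setOf_cyclotomic_dvd` — **`{n | Φ_{p^{n+1}}(1+X) ∣ f}` infinite ⇒ `f = 0`**.
* §3 **the norm trick** `eq_zero_of_sq_add_C_mul_sq_eq_zero`: `g₀² + p·g₁² = 0` in `Λ` ⇒ `g₀ = g₁ = 0` (the `p`-adic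
  valuations of the two terms have opposite parity) — used by the consumer to separate `Λ ⊕ √−p·Λ ⊂ Λ_O` although
  `√−p ∈ ℚ_p(ζ_p)` lies in the field of values.
* §4 **the kernel of evaluation at `ζ − 1`, polynomial level** `cyclotomic_comp_dvd_of_eval_eq_zero`: for a field `B`,
  a ring hom `ι : ℚ_[p] →+* B`, a primitive `p^{n+1}`-th root of unity `ζ ∈ B` and `P ∈ ℤ_p[X]`: if `P`, read in `B`
  through `ι`, vanishes at `ζ − 1`, then `Φ_{p^{n+1}}(1+X) ∣ P` in `ℤ_p[X]` (irreducibility of `Φ_{p^{n+1}}` over `ℚ_p` —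
  tree `irreducible_cyclotomic_prime_pow_comp_padic` — Bezout over `ℚ_p`, descent of a monic divisor by `modByMonic`).

HONEST FRAMING: pure commutative algebra of `Λ`; nothing about elliptic curves, zeta elements or BSD is asserted; no
summit statement is touched; stmt-BirchSwinnertonDyer-19945 stays OPEN.

## References
* L. C. Washington, *Introduction to Cyclotomic Fields*, 2nd ed. (1997): §7.1 Thm. 7.1 and Prop. 7.2 (`ω_n`,
  division by distinguished polynomials), Thm. 7.3 and Lemma 13.7 (the `p^m·f₀` reduction), §13.2. [Washington1997]
* K. Kato, Astérisque 295 (2004), §13.9 (p. 230 l. 8–9: «Since `𝐇¹(V_{F_λ}(f))` is a free `Λ[1/p]`-module of rank 1,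
  this shows that `z_γ^{(p)}` is independent of the choices») and Thm. 12.4 (2) (p. 221) — the use of the separation.
  [Kato2004Asterisque]
* J.-P. Serre, *Local Fields* (1979), IV §4 Prop. 17 (`Φ_{pⁿ}` irreducible over `ℚ_p`). [SerreLocalFields1979]
* Tree: `IwasawaAlgebraStructureProofs.lean` (`exists_eq_C_pow_mul_and_map_residue_ne_zero`, `C_natCast_p_ne_zero`),
  `IwasawaAlgebraCharIdealProofs.lean` (`prime_C`), `IwasawaAlgebraSpecializationCoprimeProofs.lean`
  (`isRelPrime_C_pow_coe_of_monic`: `p^μ` and a monic polynomial are relatively prime in `Λ`),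
  `AnabelianGeometry/EtaleTheta/RootsOfUnityGaloisPrimePower.lean` (`cyclotomic_prime_pow_comp_X_add_one_isEisensteinAt_padicInt`,
  `irreducible_cyclotomic_prime_pow_comp_padic`).
-/

noncomputable section

open Polynomial

namespace Literature.NumberTheory.EllipticCurves.IwasawaAlgebra

variable (p : ℕ) [hp : Fact p.Prime]

/-! ## §1 Distinguished-type monic polynomials divide only power series of bounded reduction order -/

/-- A monic `g ∈ ℤ_p[X]` whose non-leading coefficients are divisible by `p` reduces to `X^{deg g}` in `𝔽_p⟦X⟧`.
[cite: Washington1997, §7.1 Prop. 7.2] -/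
theorem map_residue_coe_eq_X_pow {g : ℤ_[p][X]} (hmonic : g.Monic)
    (hdvd : ∀ i < g.natDegree, (p : ℤ_[p]) ∣ g.coeff i) :
    PowerSeries.map (IsLocalRing.residue ℤ_[p]) (g : IwasawaAlgebra p) = PowerSeries.X ^ g.natDegree := by
  ext m
  rw [PowerSeries.coeff_map, Polynomial.coeff_coe, PowerSeries.coeff_X_pow]
  rcases lt_trichotomy m g.natDegree with h | h | h
  · rw [if_neg h.ne, IsLocalRing.residue_eq_zero_iff, PadicInt.maximalIdeal_eq_span_p,
      Ideal.mem_span_singleton]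
    exact hdvd m h
  · subst h
    rw [if_pos rfl, hmonic.coeff_natDegree, map_one]
  · rw [if_neg h.ne', Polynomial.coeff_eq_zero_of_natDegree_lt h, map_zero]

/-- If a monic `g ∈ ℤ_p[X]` divides `p^m·f₀` in `Λ` then it divides `f₀` (`p` is prime in `Λ` and does not divide `g`).
[cite: Washington1997, Lemma 13.7] -/
theorem coe_dvd_of_coe_dvd_C_pow_mul {g : ℤ_[p][X]} (hmonic : g.Monic) {m : ℕ} {f₀ : IwasawaAlgebra p}
    (h : (g : IwasawaAlgebra p) ∣ PowerSeries.C ((p : ℤ_[p]) ^ m) * f₀) : (g : IwasawaAlgebra p) ∣ f₀ :=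
  (isRelPrime_C_pow_coe_of_monic p hmonic m).symm.dvd_of_dvd_mul_left h

/-- If a monic `g ∈ ℤ_p[X]` with non-leading coefficients in `(p)` divides `f₀` in `Λ` and `f̄₀ ≠ 0`, then
`deg g ≤ ord_X f̄₀` (`X^{deg g} = ḡ ∣ f̄₀` in `𝔽_p⟦X⟧`). [cite: Washington1997, §7.1 Prop. 7.2 and proof of Thm. 7.3] -/
theorem natDegree_le_order_of_coe_dvd {g : ℤ_[p][X]} (hmonic : g.Monic)
    (hdvd : ∀ i < g.natDegree, (p : ℤ_[p]) ∣ g.coeff i) {f₀ : IwasawaAlgebra p}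
    (h : (g : IwasawaAlgebra p) ∣ f₀) :
    (g.natDegree : ℕ∞) ≤ (PowerSeries.map (IsLocalRing.residue ℤ_[p]) f₀).order := by
  obtain ⟨q, hq⟩ := h
  have hX : PowerSeries.X ^ g.natDegree ∣ PowerSeries.map (IsLocalRing.residue ℤ_[p]) f₀ :=
    ⟨PowerSeries.map (IsLocalRing.residue ℤ_[p]) q, by rw [hq, map_mul, map_residue_coe_eq_X_pow p hmonic hdvd]⟩
  exact PowerSeries.nat_le_order _ _ (PowerSeries.X_pow_dvd_iff.mp hX)

/-- **Degree bound**: for `f ≠ 0` in `Λ` the monic polynomials `g ∈ ℤ_p[X]` with non-leading coefficients in `(p)` and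
`(g : Λ) ∣ f` have bounded degree. [cite: Washington1997, Thm. 7.3 and Lemma 13.7] -/
theorem exists_natDegree_le_of_coe_dvd {f : IwasawaAlgebra p} (hf : f ≠ 0) :
    ∃ N : ℕ, ∀ g : ℤ_[p][X], g.Monic → (∀ i < g.natDegree, (p : ℤ_[p]) ∣ g.coeff i) →
      (g : IwasawaAlgebra p) ∣ f → g.natDegree ≤ N := by
  obtain ⟨m, f₀, rfl, hf₀⟩ := exists_eq_C_pow_mul_and_map_residue_ne_zero p hf
  have hfin : (PowerSeries.map (IsLocalRing.residue ℤ_[p]) f₀).order ≠ ⊤ := by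
    rwa [Ne, PowerSeries.order_eq_top]
  obtain ⟨N, hN⟩ := ENat.ne_top_iff_exists.mp hfin
  refine ⟨N, fun g hmo hdv hg => ?_⟩
  have h1 := natDegree_le_order_of_coe_dvd p hmo hdv (coe_dvd_of_coe_dvd_C_pow_mul p hmo hg)
  rw [← hN] at h1
  exact_mod_cast h1

/-- For `f ≠ 0`, a family `g n` of monic polynomials with non-leading coefficients in `(p)` and UNBOUNDED degrees has
only finitely many members dividing `f` in `Λ`. [cite: Washington1997, Thm. 7.3] -/
theorem finite_setOf_coe_dvd {f : IwasawaAlgebra p} (hf : f ≠ 0) (g : ℕ → ℤ_[p][X])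
    (hmo : ∀ n, (g n).Monic) (hdv : ∀ n, ∀ i < (g n).natDegree, (p : ℤ_[p]) ∣ (g n).coeff i)
    (hdeg : ∀ N : ℕ, {n | (g n).natDegree ≤ N}.Finite) :
    {n | (g n : IwasawaAlgebra p) ∣ f}.Finite := by
  obtain ⟨N, hN⟩ := exists_natDegree_le_of_coe_dvd p hf
  exact (hdeg N).subset fun n hn => hN (g n) (hmo n) (hdv n) hn

/-- **Separation, family form**: if infinitely many members of such a family divide `f`, then `f = 0`.
[cite: Washington1997, Thm. 7.3] [cite: Kato2004Asterisque, §13.9 (p. 230)] -/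
theorem eq_zero_of_infinite_setOf_coe_dvd {f : IwasawaAlgebra p} (g : ℕ → ℤ_[p][X])
    (hmo : ∀ n, (g n).Monic) (hdv : ∀ n, ∀ i < (g n).natDegree, (p : ℤ_[p]) ∣ (g n).coeff i)
    (hdeg : ∀ N : ℕ, {n | (g n).natDegree ≤ N}.Finite)
    (hinf : {n | (g n : IwasawaAlgebra p) ∣ f}.Infinite) : f = 0 := by
  by_contra hf
  exact hinf (finite_setOf_coe_dvd p hf g hmo hdv hdeg)

/-! ## §2 The cyclotomic family `Φ_{p^{n+1}}(1+X)` -/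

/-- `Φ_{p^{n+1}}(X+1) ∈ ℤ_p[X]` is monic. [cite: Washington1997, Ch. 2 §1 (p. 12: `Φ_n` monic of degree `φ(n)` with integer coefficients)] -/
theorem monic_cyclotomic_comp (n : ℕ) :
    (((cyclotomic (p ^ (n + 1)) ℤ).comp (X + 1)).map (Int.castRingHom ℤ_[p])).Monic := by
  refine Polynomial.Monic.map _ ?_
  rw [show (X + 1 : ℤ[X]) = X + C 1 by simp]
  refine (cyclotomic.monic _ ℤ).comp (monic_X_add_C 1) fun h => ?_
  rw [natDegree_X_add_C] at h
  exact zero_ne_one h.symm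

/-- `deg Φ_{p^{n+1}}(X+1) = pⁿ(p − 1)`. [cite: Washington1997, Ch. 2 §1 (p. 12)] -/
theorem natDegree_cyclotomic_comp (n : ℕ) :
    (((cyclotomic (p ^ (n + 1)) ℤ).comp (X + 1)).map (Int.castRingHom ℤ_[p])).natDegree = p ^ n * (p - 1) := by
  have hmo : ((cyclotomic (p ^ (n + 1)) ℤ).comp (X + 1)).Monic := by
    rw [show (X + 1 : ℤ[X]) = X + C 1 by simp]
    refine (cyclotomic.monic _ ℤ).comp (monic_X_add_C 1) fun h => ?_
    rw [natDegree_X_add_C] at h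
    exact zero_ne_one h.symm
  rw [hmo.natDegree_map, natDegree_comp, show (X + 1 : ℤ[X]) = X + C 1 by simp, natDegree_X_add_C, mul_one,
    natDegree_cyclotomic, Nat.totient_prime_pow hp.out n.succ_pos]
  simp

/-- The non-leading coefficients of `Φ_{p^{n+1}}(X+1)` are divisible by `p` (Eisenstein at `p`, tree).
[cite: SerreLocalFields1979, IV §4 Prop 17] -/
theorem dvd_coeff_cyclotomic_comp (n : ℕ) :
    ∀ i < (((cyclotomic (p ^ (n + 1)) ℤ).comp (X + 1)).map (Int.castRingHom ℤ_[p])).natDegree,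
      (p : ℤ_[p]) ∣ (((cyclotomic (p ^ (n + 1)) ℤ).comp (X + 1)).map (Int.castRingHom ℤ_[p])).coeff i := by
  intro i hi
  have h := (Literature.AnabelianGeometry.EtaleTheta.cyclotomic_prime_pow_comp_X_add_one_isEisensteinAt_padicInt p n).mem hi
  rwa [PadicInt.maximalIdeal_eq_span_p, Ideal.mem_span_singleton] at h

/-- The degrees `pⁿ(p−1)` are unbounded: only finitely many `n` have `deg Φ_{p^{n+1}}(X+1) ≤ N`. [cite: Washington1997, Ch. 2 §1 (p. 12)] -/
theorem finite_setOf_natDegree_cyclotomic_comp_le (N : ℕ) :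
    {n : ℕ | (((cyclotomic (p ^ (n + 1)) ℤ).comp (X + 1)).map (Int.castRingHom ℤ_[p])).natDegree ≤ N}.Finite := by
  refine (Set.finite_le_nat N).subset fun n hn => ?_
  simp only [Set.mem_setOf_eq, natDegree_cyclotomic_comp] at hn ⊢
  have h1 : 1 ≤ p - 1 := by have := hp.out.two_le; omega
  have h2 : n < p ^ n := Nat.lt_pow_self hp.out.one_lt
  calc n ≤ p ^ n := h2.le
    _ ≤ p ^ n * (p - 1) := Nat.le_mul_of_pos_right _ h1
    _ ≤ N := hn

/-- `Φ_{p^{n+1}}(1+X)` divides `ω_{n+1} = (1+X)^{p^{n+1}} − 1` in `Λ` (`Φ_N ∣ X^N − 1`, shifted).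
[cite: Washington1997, §7.1 Thm. 7.1] -/
theorem coe_cyclotomic_comp_dvd_omega (n : ℕ) :
    ((((cyclotomic (p ^ (n + 1)) ℤ).comp (X + 1)).map (Int.castRingHom ℤ_[p]) : ℤ_[p][X]) : IwasawaAlgebra p) ∣
      (1 + PowerSeries.X : IwasawaAlgebra p) ^ p ^ (n + 1) - 1 := by
  obtain ⟨q, hq⟩ := cyclotomic.dvd_X_pow_sub_one (p ^ (n + 1)) ℤ
  refine ⟨((q.comp (X + 1)).map (Int.castRingHom ℤ_[p]) : ℤ_[p][X]), ?_⟩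
  rw [← Polynomial.coe_mul, ← Polynomial.map_mul, ← Polynomial.mul_comp, ← hq]
  have e1 : ((X ^ p ^ (n + 1) - 1 : ℤ[X]).comp (X + 1)).map (Int.castRingHom ℤ_[p]) =
      (X + 1) ^ p ^ (n + 1) - 1 := by
    simp [sub_comp]
  rw [e1, ← Polynomial.coeToPowerSeries.ringHom_apply, map_sub, map_pow, map_add, map_one,
    Polynomial.coeToPowerSeries.ringHom_apply, Polynomial.coe_X, add_comm]

/-- ★ **Separation by cyclotomic specialisations**: a power series `f ∈ Λ = ℤ_p⟦X⟧` divisible by `Φ_{p^{n+1}}(1+X)`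
for infinitely many `n` is `0` — the scalar half of Kato's «elements with the same values at almost all characters are
equal» (§13.9, via Thm. 12.4 (2)). [cite: Kato2004Asterisque, §13.9 (p. 230 l. 8–9)] [cite: Washington1997, Thm. 7.3] -/
theorem eq_zero_of_infinite_setOf_cyclotomic_dvd {f : IwasawaAlgebra p}
    (hinf : {n : ℕ | ((((cyclotomic (p ^ (n + 1)) ℤ).comp (X + 1)).map (Int.castRingHom ℤ_[p]) : ℤ_[p][X]) :
      IwasawaAlgebra p) ∣ f}.Infinite) : f = 0 :=
  eq_zero_of_infinite_setOf_coe_dvd p (fun n => ((cyclotomic (p ^ (n + 1)) ℤ).comp (X + 1)).map (Int.castRingHom ℤ_[p]))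
    (monic_cyclotomic_comp p) (dvd_coeff_cyclotomic_comp p) (finite_setOf_natDegree_cyclotomic_comp_le p) hinf

/-! ## §3 The norm trick: `g₀² + p·g₁² = 0 ⇒ g₀ = g₁ = 0` -/

/-- **`g₀² + p·g₁² = 0` in `Λ` forces `g₀ = g₁ = 0`**: writing `g_i = p^{m_i}·h_i` with `h̄_i ≠ 0`, the identity
`p^{2m₀} h₀² = −p^{2m₁+1} h₁²` is impossible (`p` prime in the domain `Λ`, `h̄₀² ≠ 0`, parities differ).  Used to split an
identity `ev(g₀) + √−p·ev(g₁) = 0` at infinitely many characters into `g₀ = g₁ = 0`, although `√−p ∈ ℚ_p(ζ_p)`.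
[cite: Washington1997, §13.2] -/
theorem eq_zero_of_sq_add_C_mul_sq_eq_zero {g₀ g₁ : IwasawaAlgebra p}
    (h : g₀ ^ 2 + PowerSeries.C (p : ℤ_[p]) * g₁ ^ 2 = 0) : g₀ = 0 ∧ g₁ = 0 := by
  classical
  -- `p`-adic valuation parity: use `emultiplicity` of the prime `C p` in the domain `Λ`
  have hprime : Prime (PowerSeries.C (p : ℤ_[p]) : IwasawaAlgebra p) := prime_C p
  by_cases hg₁ : g₁ = 0
  · subst hg₁
    simp only [ne_eq, OfNat.ofNat_ne_zero, not_false_eq_true, zero_pow, mul_zero, add_zero,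
      pow_eq_zero_iff] at h
    exact ⟨h, rfl⟩
  exfalso
  have hg₀ : g₀ ≠ 0 := by
    rintro rfl
    simp only [ne_eq, OfNat.ofNat_ne_zero, not_false_eq_true, zero_pow, zero_add, mul_eq_zero,
      pow_eq_zero_iff] at h
    rcases h with h | h
    · exact C_natCast_p_ne_zero p h
    · exact hg₁ h
  have heq : g₀ ^ 2 = -(PowerSeries.C (p : ℤ_[p]) * g₁ ^ 2) := eq_neg_of_add_eq_zero_left h
  have hfin₀ : FiniteMultiplicity (PowerSeries.C (p : ℤ_[p]) : IwasawaAlgebra p) g₀ :=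
    FiniteMultiplicity.of_prime_left hprime hg₀
  have hfin₁ : FiniteMultiplicity (PowerSeries.C (p : ℤ_[p]) : IwasawaAlgebra p) g₁ :=
    FiniteMultiplicity.of_prime_left hprime hg₁
  have h0 : emultiplicity (PowerSeries.C (p : ℤ_[p]) : IwasawaAlgebra p) (g₀ ^ 2) =
      2 * emultiplicity (PowerSeries.C (p : ℤ_[p]) : IwasawaAlgebra p) g₀ := emultiplicity_pow hprime
  have h1 : emultiplicity (PowerSeries.C (p : ℤ_[p]) : IwasawaAlgebra p) (-(PowerSeries.C (p : ℤ_[p]) * g₁ ^ 2)) =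
      1 + 2 * emultiplicity (PowerSeries.C (p : ℤ_[p]) : IwasawaAlgebra p) g₁ := by
    rw [emultiplicity_neg, emultiplicity_mul hprime, emultiplicity_pow hprime,
      (FiniteMultiplicity.of_prime_left hprime hprime.ne_zero).emultiplicity_self]
    norm_cast
  rw [heq, h1, hfin₀.emultiplicity_eq_multiplicity, hfin₁.emultiplicity_eq_multiplicity] at h0
  have h4 : 1 + 2 * multiplicity (PowerSeries.C (p : ℤ_[p]) : IwasawaAlgebra p) g₁ =
      2 * multiplicity (PowerSeries.C (p : ℤ_[p]) : IwasawaAlgebra p) g₀ := by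
    exact_mod_cast h0
  omega

/-! ## §4 The kernel of evaluation at `ζ − 1`, at the level of polynomials -/

/-- The base change `ℤ_p[X] → ℚ_p[X]` of `Φ_{p^{n+1}}(X+1)` (`Φ_n` has integer coefficients). [cite: Washington1997, Ch. 2 §1 (p. 12)] -/
theorem map_cyclotomic_comp (n : ℕ) :
    (((cyclotomic (p ^ (n + 1)) ℤ).comp (X + 1)).map (Int.castRingHom ℤ_[p])).map (algebraMap ℤ_[p] ℚ_[p]) =
      (cyclotomic (p ^ (n + 1)) ℚ_[p]).comp (X + 1) := by
  rw [Polynomial.map_map, map_comp, Polynomial.map_add, map_X, Polynomial.map_one]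
  congr 1
  have : (algebraMap ℤ_[p] ℚ_[p]).comp (Int.castRingHom ℤ_[p]) = Int.castRingHom ℚ_[p] :=
    RingHom.ext_int _ _
  rw [this, map_cyclotomic_int]

/-- **Kernel of evaluation at `ζ − 1`**: for a field `B`, `ι : ℚ_p →+* B`, a PRIMITIVE `p^{n+1}`-th root of unity `ζ ∈ B`
and `P ∈ ℤ_p[X]` with `P^ι(ζ − 1) = 0`, the polynomial `Φ_{p^{n+1}}(X+1)` divides `P` in `ℤ_p[X]` (irreducibility of
`Φ_{p^{n+1}}` over `ℚ_p` + Bezout + descent of a monic divisor). [cite: SerreLocalFields1979, IV §4 Prop 17] -/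
theorem cyclotomic_comp_dvd_of_eval_eq_zero (n : ℕ) {B : Type*} [Field B] (ι : ℚ_[p] →+* B) {ζ : B}
    (hζ : IsPrimitiveRoot ζ (p ^ (n + 1))) {P : ℤ_[p][X]}
    (hP : (P.map (ι.comp (algebraMap ℤ_[p] ℚ_[p]))).eval (ζ - 1) = 0) :
    ((cyclotomic (p ^ (n + 1)) ℤ).comp (X + 1)).map (Int.castRingHom ℤ_[p]) ∣ P := by
  set G := ((cyclotomic (p ^ (n + 1)) ℤ).comp (X + 1)).map (Int.castRingHom ℤ_[p]) with hG
  have hGmo : G.Monic := monic_cyclotomic_comp p n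
  -- over `ℚ_p`: `G ∣ P` by irreducibility and the common root `ζ − 1` in `B`
  have hirr : Irreducible (G.map (algebraMap ℤ_[p] ℚ_[p])) := by
    rw [hG, map_cyclotomic_comp]
    exact Literature.AnabelianGeometry.EtaleTheta.irreducible_cyclotomic_prime_pow_comp_padic p n
  have hroot : ((G.map (algebraMap ℤ_[p] ℚ_[p])).map ι).eval (ζ - 1) = 0 := by
    rw [hG, map_cyclotomic_comp, Polynomial.map_comp, Polynomial.map_add, map_X, Polynomial.map_one,
      map_cyclotomic, eval_comp, eval_add, eval_X, eval_one, sub_add_cancel]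
    exact (hζ.isRoot_cyclotomic (pow_pos hp.out.pos _)).eq_zero
  have hdvdQ : G.map (algebraMap ℤ_[p] ℚ_[p]) ∣ P.map (algebraMap ℤ_[p] ℚ_[p]) := by
    by_contra hnd
    have hcop : IsCoprime (G.map (algebraMap ℤ_[p] ℚ_[p])) (P.map (algebraMap ℤ_[p] ℚ_[p])) :=
      (EuclideanDomain.dvd_or_coprime _ _ hirr).resolve_left hnd
    obtain ⟨a, b, hab⟩ := hcop
    have := congrArg (fun Q : ℚ_[p][X] => (Q.map ι).eval (ζ - 1)) hab
    simp only [Polynomial.map_add, Polynomial.map_mul, eval_add, eval_mul, Polynomial.map_one, eval_one,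
      hroot, mul_zero, zero_add] at this
    rw [Polynomial.map_map] at this
    rw [hP, mul_zero] at this
    exact zero_ne_one this
  -- descent of the monic divisor from `ℚ_p[X]` to `ℤ_p[X]`
  rw [← modByMonic_eq_zero_iff_dvd hGmo]
  have hinj : Function.Injective (algebraMap ℤ_[p] ℚ_[p]) := IsFractionRing.injective ℤ_[p] ℚ_[p]
  apply Polynomial.map_injective _ hinj
  rw [Polynomial.map_modByMonic _ hGmo, Polynomial.map_zero,
    (modByMonic_eq_zero_iff_dvd (hGmo.map _)).mpr hdvdQ]

end Literature.NumberTheory.EllipticCurves.IwasawaAlgebra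

end
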